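import Mathlib
import Literature.AlgebraicGeometry.Resolution.ProperModelsPatching
import Literature.AlgebraicGeometry.Morphisms.OpenGluing
import Literature.AlgebraicGeometry.Resolution.LocalRegLeificationOfSandwiched

/-!
# Crux `PatchingRel` (stmt-ResolutionOfSingularities-0642), line `sandwiched-gluing`,
# stub `stub_localRegLeification_of_sandwiched`

The geometric heart of the line: the named fact `OpenGluing.{0}` (Stacks 01LH, two pieces)
together with strong resolution of sandwiched schemes in characteristic `p`
(`SandwichedStrongResolution.{0} p`, `ProperModelsPatching.lean`) gives the local
RegLe-ification of every morphism `φ : M → Y` of proper models of a function field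
(`ProperModel.LocalRegLeification.{0} p`): resolve the sandwiched piece
`V = φ⁻¹(Reg Y) → Reg Y` strongly (`π : Yv → V`, an isomorphism over `Reg V`) and glue `Yv` to
`M ∖ closure (Sing V)` along `Reg V`. This is the universe-`0` instance of the tree theorem
`Literature.AlgebraicGeometry.Resolution.ProperModel.localRegLeification_of_sandwiched`
(`LocalRegLeificationOfSandwiched.lean`; gluing core `SandwichedGluingLocal.lean`, topology of
`closure (Sing V)` in `SingularLocusClosure.lean`).
-/

noncomputable section

open CategoryTheory AlgebraicGeometry
open Literature.AlgebraicGeometry.Resolution Literature.AlgebraicGeometry.Morphisms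

-- `Summit.<Summit>.<Sub>.Theorems` with `Sub = Summit` (single-conjunct summit, D-0017): the duplicated
-- namespace component is the tree layout.
set_option linter.dupNamespace false

namespace Summit.ResolutionOfSingularities.ResolutionOfSingularities.Theorems

/-- **Stub `stub_localRegLeification_of_sandwiched` of line `sandwiched-gluing`** (crux
`PatchingRel`, stmt-ResolutionOfSingularities-0642): `OpenGluing` + SAND⁺(p) ⇒
`ProperModel.LocalRegLeification p`. For `φ : M → Y`: `U := Reg Y` is open (finite type over a
field) and contains the generic point, `V := φ⁻¹(U)` is a non-empty open of `M`, `V → U` is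
proper and birational over the regular integral `U`, so SAND⁺ gives `π : Yv → V` proper
birational with `Yv` regular and `π` an isomorphism over `W = Reg V`; with
`C := closure (Sing V)` (`C ∩ V = Sing V`, `C ⊆ Sing M`) glue `Yv` to `M ∖ C` along `W` inside
`O := V ∪ (M ∖ C) ⊇ Reg M ∪ φ⁻¹(Reg Y)` by `OpenGluing`; the glued `N → O` is proper,
birational, `N` integral, regular over `Reg M` (there it is `M`) and over `φ⁻¹(Reg Y)` (there it
is `Yv`) (`ProperModel.localRegLeification_of_sandwiched`).
[cite: Piltant2013, proof of Prop. 5.1, Steps 4-5] -/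
theorem stub_localRegLeification_of_sandwiched : ∀ p : ℕ,
    OpenGluing.{0} → SandwichedStrongResolution.{0} p → ProperModel.LocalRegLeification.{0} p :=
  fun p hOG hS => ProperModel.localRegLeification_of_sandwiched p hOG hS

end Summit.ResolutionOfSingularities.ResolutionOfSingularities.Theorems

end
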